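import Literature.AnabelianGeometry.EtaleTheta.ContH1CyclicExtension
import Mathlib.Data.ZMod.Basic
import HarnessLib

/-!
# Continuous `H¹`: extending an invariant class along a CYCLIC quotient, II — the finite cyclic case
# (support file for [EtTh] §1–§2)

Sequel of `ContH1CyclicExtension.lean` (same setting: `N ≤ H ≤ G`, `N` open, coefficients an abelian
normal subgroup `A ≤ G'` acted on by conjugation through a continuous `φ : G →* G'`; `t ∈ H`).  Here
`H/N ≅ ℤ/m` (a character `χ : H → ℤ/m` with kernel `N`, `χ(t) = 1`, so `s := t^m ∈ N`), and the
transgression obstruction to extending a `t`-invariant class of `H¹(N, A)` lives in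
`H²(ℤ/m, A^N) = (A^N)^t / N_t A^N` [cite: NeukirchSchmidtWingberg2008, I §6 Prop 1.6.7]:

* `SemidirectProduct.left_mk_pow_succ` — `((b,h)^(k+1)).1 = ((b,h)^k).1 · ^{h^k}b` (so `((b,t)^m).1` is the
  "norm" `b · ᵗb ⋯ ^{t^{m-1}}b`);
* `exists_contCocycle_extension_of_zmod` — given the `t`-invariance identity with witness `b` AND the NORM
  CONDITION `f(t^m) = ((b,t)^m).1`, the cocycle `f` extends to a cocycle `F` on `H` with `F|_N = f`,
  `F(t) = b` (the norm condition is forced: it is the value any such `F` takes at `t^m`).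

Classical; no anabelian content; nothing of [EtTh] is asserted.  In the [EtTh] §2 use (`m = 2`,
`A = Δ_Θ/l·Δ_Θ` of odd order `l`) the norm condition can always be arranged by changing the witness `b`
(squaring is bijective on `A`) — recorded for the consumer in the docstring of
`exists_contCocycle_extension_of_zmod`.  Seat abc-iut-w5-d234 (wave-5 prover), for the L2 residual "x1"
named by abc-iut-L2-t7.
-/

namespace Literature.AnabelianGeometry.EtaleTheta

namespace ContH1

open scoped IsMulCommutative

variable {G G' : Type*} [Group G] [TopologicalSpace G] [IsTopologicalGroup G]
  [Group G'] [TopologicalSpace G'] [IsTopologicalGroup G']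
  {φ : G →* G'} {A : Subgroup G'} [A.Normal] [IsMulCommutative A]
  {N H : Subgroup G}

omit [TopologicalSpace G] [IsTopologicalGroup G] in
/-- If `N ≤ H` is the kernel of a homomorphism out of `H`, then `N` is normal in `H`. [folklore] -/
private theorem conj_mem_of_ker' {Q : Type*} [Group Q] (hNH : N ≤ H) (χ : ↥H →* Q)
    (hker : ∀ h : ↥H, χ h = 1 ↔ (h : G) ∈ N) : ∀ h ∈ H, ∀ n ∈ N, h * n * h⁻¹ ∈ N := by
  intro h hh n hn
  have h1 : χ ⟨n, hNH hn⟩ = 1 := (hker ⟨n, hNH hn⟩).2 hn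
  have h2 : χ (⟨h, hh⟩ * ⟨n, hNH hn⟩ * (⟨h, hh⟩)⁻¹) = 1 := by
    rw [map_mul, map_mul, map_inv, h1, mul_one, mul_inv_cancel]
  exact (hker _).1 h2

/-- Powers of `(b, h)` in a semidirect product, first component: `((b,h)^(k+1)).1 = ((b,h)^k).1 · ^{h^k}b`.
(For `k = 1`: `((b,h)²).1 = b · ʰb`; iterating, `((b,h)^m).1 = b · ʰb ⋯ ^{h^{m-1}}b` is the NORM element of
`b` for the cyclic group generated by `h`.) [cite: NeukirchSchmidtWingberg2008, I §6 Prop 1.6.7] -/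
theorem _root_.SemidirectProduct.left_mk_pow_succ {M K : Type*} [Group M] [Group K] (θ : K →* MulAut M)
    (b : M) (h : K) (k : ℕ) :
    ((⟨b, h⟩ : M ⋊[θ] K) ^ (k + 1)).left = ((⟨b, h⟩ : M ⋊[θ] K) ^ k).left * θ (h ^ k) b := by
  have hr : ((⟨b, h⟩ : M ⋊[θ] K) ^ k).right = h ^ k := by
    change SemidirectProduct.rightHom ((⟨b, h⟩ : M ⋊[θ] K) ^ k) = h ^ k
    rw [map_pow]
    rfl
  rw [pow_succ, SemidirectProduct.mul_left, hr]

/-! ### Finite cyclic quotient: the norm condition -/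

/-- **Extending a `t`-invariant class along a FINITE CYCLIC quotient, given the norm condition.**  Let
`N ≤ H ≤ G` with `N` open in `G`, `χ : H → ℤ/m` a homomorphism with kernel `N`, `t ∈ H` with `χ(t) = 1`
(so `H/N ≅ ℤ/m` generated by `t`, and `s := t^m ∈ N`), and `f` a continuous cocycle on `N` whose class is
`t`-invariant with witness `b` (`f(t n t⁻¹) = b · ᵗf(n) · (ᵗⁿᵗ⁻¹b)⁻¹`).  If moreover the NORM CONDITION
`f(t^m) = b · ᵗb ⋯ ^{t^{m-1}}b` holds — the right-hand side is the first component of `(b,t)^m ∈ A ⋊ H`,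
unfolded by `SemidirectProduct.left_mk_pow_succ` — then `f` extends to a continuous cocycle `F` on `H`
with `F|_N = f` and `F(t) = b`.  (The norm condition is the vanishing of the obstruction in
`H²(ℤ/m, A^N) = (A^N)^t / N_t A^N`; it is FORCED: any extension `F` with `F(t) = b` has `F(t^m)` equal to
that product.) [cite: NeukirchSchmidtWingberg2008, I §6 Prop 1.6.7] -/
theorem exists_contCocycle_extension_of_zmod (hφ : Continuous φ) (hNopen : IsOpen (N : Set G))
    (hNH : N ≤ H) {m : ℕ} [NeZero m] (χ : ↥H →* Multiplicative (ZMod m))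
    (hker : ∀ h : ↥H, χ h = 1 ↔ (h : G) ∈ N)
    {t : G} (ht : t ∈ H) (hχt : χ ⟨t, ht⟩ = Multiplicative.ofAdd 1)
    (f : contCocycles φ A N) (b : ↥A)
    (hinv : ∀ (n : G) (hn : n ∈ N) (htn : t * n * t⁻¹ ∈ N), f.1 ⟨t * n * t⁻¹, htn⟩ =
      b * MulAut.conjNormal (φ t) (f.1 ⟨n, hn⟩) * (MulAut.conjNormal (φ (t * n * t⁻¹)) b)⁻¹)
    (hnorm : ∀ hs : t ^ m ∈ N, f.1 ⟨t ^ m, hs⟩ = ((⟨b, ⟨t, ht⟩⟩ : ↥A ⋊[conjAut φ A H] ↥H) ^ m).left) :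
    ∃ F : contCocycles φ A H, (∀ n : ↥N, F.1 ⟨n, hNH n.2⟩ = f.1 n) ∧ F.1 ⟨t, ht⟩ = b := by
  have hN : ∀ h ∈ H, ∀ n ∈ N, h * n * h⁻¹ ∈ N := conj_mem_of_ker' hNH χ hker
  have hI := toSemidirect_conj_of_inv hNH hN ht f b (fun n => hinv n n.2 _)
  set x : ↥A ⋊[conjAut φ A H] ↥H := ⟨b, ⟨t, ht⟩⟩ with hx
  have right_pow : ∀ k : ℕ, (x ^ k).right = ⟨t, ht⟩ ^ k := fun k => by
    change SemidirectProduct.rightHom (x ^ k) = _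
    rw [map_pow]
    rfl
  -- `s = t ^ m ∈ N` and `s_f(s) = x ^ m`
  have hχpow : ∀ k : ℕ, χ (⟨t, ht⟩ ^ k) = Multiplicative.ofAdd (k : ZMod m) := fun k => by
    rw [map_pow, hχt, ← ofAdd_nsmul, nsmul_eq_mul, mul_one]
  have hs : t ^ m ∈ N := by
    have h1 : χ (⟨t, ht⟩ ^ m) = 1 := by
      rw [hχpow, ZMod.natCast_self]
      rfl
    have := (hker _).1 h1
    simpa only [SubgroupClass.coe_pow] using this
  have hsx : toSemidirect hNH f ⟨t ^ m, hs⟩ = x ^ m := by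
    ext
    · rw [toSemidirect_left, hnorm hs]
    · rw [toSemidirect_right, right_pow]
      simp only [SubgroupClass.coe_pow]
  -- the exponent function: the least nonnegative residue
  let κ : ↥H → ℤ := fun h => ((Multiplicative.toAdd (χ h)).val : ℤ)
  have hκN : ∀ h : ↥H, (h : G) * t ^ (-κ h) ∈ N := by
    intro h
    have hmem : (h : G) * t ^ (-κ h) ∈ H := H.mul_mem h.2 (H.zpow_mem ht _)
    have heq : (⟨(h : G) * t ^ (-κ h), hmem⟩ : ↥H) = h * (⟨t, ht⟩ ^ (Multiplicative.toAdd (χ h)).val)⁻¹ :=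
      Subtype.ext (by simp only [κ, Subgroup.coe_mul, Subgroup.coe_inv, SubgroupClass.coe_pow,
        zpow_neg, zpow_natCast])
    have h1 : χ ⟨(h : G) * t ^ (-κ h), hmem⟩ = 1 := by
      rw [heq, map_mul, map_inv, hχpow, ZMod.natCast_zmod_val]
      apply Multiplicative.toAdd.injective
      simp
    exact (hker _).1 h1
  have hκ : ∀ h h' : ↥H, (h' : G) * (h : G)⁻¹ ∈ N → κ h' = κ h := by
    intro h h' hm
    have h1 : χ (h' * h⁻¹) = 1 := (hker (h' * h⁻¹)).2 (by simpa using hm)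
    rw [map_mul, map_inv, mul_inv_eq_one] at h1
    simp only [κ, h1]
  have hκmul : ∀ h h' : ↥H, ∃ he : t ^ (κ h + κ h' - κ (h * h')) ∈ N,
      toSemidirect hNH f ⟨_, he⟩ = x ^ (κ h + κ h' - κ (h * h')) := by
    intro h h'
    have key : ∀ e : ℤ, (e = 0 ∨ e = m) → ∃ he : t ^ e ∈ N, toSemidirect hNH f ⟨t ^ e, he⟩ = x ^ e := by
      rintro e (rfl | rfl)
      · refine ⟨by simp, ?_⟩
        have h1 : (⟨t ^ (0 : ℤ), by simp⟩ : ↥N) = 1 := Subtype.ext (by simp)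
        rw [h1, map_one, zpow_zero]
      · refine ⟨by simpa only [zpow_natCast] using hs, ?_⟩
        have h1 : (⟨t ^ (m : ℤ), by simpa only [zpow_natCast] using hs⟩ : ↥N) = ⟨t ^ m, hs⟩ :=
          Subtype.ext (by simp only [zpow_natCast])
        rw [h1, hsx, zpow_natCast]
    apply key
    -- `val a + val a' - val (a + a') ∈ {0, m}`
    set a := Multiplicative.toAdd (χ h) with ha
    set a' := Multiplicative.toAdd (χ h') with ha'
    have hval : (Multiplicative.toAdd (χ (h * h'))).val = (a.val + a'.val) % m := by
      rw [map_mul, toAdd_mul, ← ha, ← ha', ZMod.val_add]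
    have hdm := Nat.div_add_mod (a.val + a'.val) m
    have hq : (a.val + a'.val) / m < 2 :=
      Nat.div_lt_of_lt_mul (by have := a.val_lt; have := a'.val_lt; omega)
    simp only [κ, hval, ← ha, ← ha']
    rcases Nat.lt_succ_iff.mp hq |>.eq_or_lt with h2 | h2
    · right
      have : a.val + a'.val = m + (a.val + a'.val) % m := by
        rw [h2, mul_one] at hdm; omega
      generalize (a.val + a'.val) % m = r at *
      omega
    · left
      have h0 : (a.val + a'.val) / m = 0 := Nat.lt_one_iff.mp h2
      rw [h0, mul_zero, zero_add] at hdm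
      generalize (a.val + a'.val) % m = r at *
      omega
  have hκt : (toSemidirect hNH f ⟨t * t ^ (-κ ⟨t, ht⟩), hκN ⟨t, ht⟩⟩ * x ^ κ ⟨t, ht⟩).left = b := by
    have hκt' : κ ⟨t, ht⟩ = ((1 % m : ℕ) : ℤ) := by
      simp only [κ, hχt, toAdd_ofAdd, ZMod.val_one_eq_one_mod]
    have key : ∀ (k : ℤ), k = ((1 % m : ℕ) : ℤ) → ∀ hm : t * t ^ (-k) ∈ N,
        (toSemidirect hNH f ⟨t * t ^ (-k), hm⟩ * x ^ k).left = b := by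
      rintro k rfl hm
      rcases Nat.eq_or_lt_of_le (NeZero.one_le (n := m)) with h1 | h1
      · -- `m = 1`: `κ t = 0`, and the norm condition reads `f(t) = b`
        have hmod : 1 % m = 0 := by rw [← h1]
        have htN : t ∈ N := by simpa [hmod] using hm
        have h2 : (⟨t * t ^ (-((1 % m : ℕ) : ℤ)), hm⟩ : ↥N) = ⟨t ^ m, hs⟩ :=
          Subtype.ext (by simp [← h1])
        rw [h2, hsx, hmod]
        simp only [Nat.cast_zero, zpow_zero, mul_one, ← h1, pow_one]
        rfl
      · -- `m ≥ 2`: `κ t = 1`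
        have hmod : 1 % m = 1 := Nat.mod_eq_of_lt h1
        have h2 : (⟨t * t ^ (-((1 % m : ℕ) : ℤ)), hm⟩ : ↥N) = 1 := Subtype.ext (by simp [hmod])
        rw [h2, map_one, one_mul, hmod]
        simp only [Nat.cast_one, zpow_one]
        rfl
    exact key _ hκt' _
  exact exists_contCocycle_extension_core hφ hNopen hNH hN ht f b hI κ hκN hκ hκmul hκt

/-! ### Arranging the norm condition when `x ↦ x^m` is bijective on `A` -/

/-- Norm elements of `b` and of `b·c` for a `θ(h)`-FIXED `c` differ by `c^k`:
`((b c, h)^k).1 = ((b, h)^k).1 · c^k`. [cite: NeukirchSchmidtWingberg2008, I §6 Prop 1.6.7] -/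
theorem _root_.SemidirectProduct.left_mk_mul_pow_of_fixed {M K : Type*} [CommGroup M] [Group K]
    (θ : K →* MulAut M) (b c : M) (h : K) (hc : θ h c = c) (k : ℕ) :
    ((⟨b * c, h⟩ : M ⋊[θ] K) ^ k).left = ((⟨b, h⟩ : M ⋊[θ] K) ^ k).left * c ^ k := by
  have hck : ∀ j : ℕ, θ (h ^ j) c = c := by
    intro j
    induction j with
    | zero => simp
    | succ j ih => rw [pow_succ', map_mul, MulAut.mul_apply, ih, hc]
  induction k with
  | zero => simp
  | succ k ih =>
    rw [SemidirectProduct.left_mk_pow_succ, SemidirectProduct.left_mk_pow_succ, ih, map_mul, hck,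
      pow_succ]
    simp only [mul_assoc, mul_comm, mul_left_comm]

/-- **Extending a `t`-invariant class along a finite cyclic quotient of order `m` when `x ↦ x^m` is
bijective on the coefficients** (e.g. `A` finite of order prime to `m`; the [EtTh] §2 use has `m = 2`,
`A = Δ_Θ/l·Δ_Θ` with `l` odd): then `H²(ℤ/m, A^N) = 0`, and concretely the norm condition of
`exists_contCocycle_extension_of_zmod` can be ARRANGED by replacing the witness `b` by `b·c` for a
(unique) `c ∈ A` fixed by `φ(N)` and `φ(t)` — so EVERY cocycle on `N` with `t`-invariant class extends to
`H`, with `F|_N = f` and `F(t) = b·c`.  Proof: `u := s_f(t^m)⁻¹ (b,t)^m ∈ A ⋊ H` lies over `1`, centralises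
`s_f(N)` and is fixed by `(b,t)`, so `u = (d, 1)` with `d ∈ A` fixed by `N` and `t`; take `c := (d⁻¹)^{1/m}`.
[cite: NeukirchSchmidtWingberg2008, I §6 Prop 1.6.7] -/
theorem exists_contCocycle_extension_of_zmod_of_powBijective (hφ : Continuous φ)
    (hNopen : IsOpen (N : Set G)) (hNH : N ≤ H) {m : ℕ} [NeZero m] (χ : ↥H →* Multiplicative (ZMod m))
    (hker : ∀ h : ↥H, χ h = 1 ↔ (h : G) ∈ N)
    {t : G} (ht : t ∈ H) (hχt : χ ⟨t, ht⟩ = Multiplicative.ofAdd 1)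
    (f : contCocycles φ A N) (b : ↥A)
    (hinv : ∀ (n : G) (hn : n ∈ N) (htn : t * n * t⁻¹ ∈ N), f.1 ⟨t * n * t⁻¹, htn⟩ =
      b * MulAut.conjNormal (φ t) (f.1 ⟨n, hn⟩) * (MulAut.conjNormal (φ (t * n * t⁻¹)) b)⁻¹)
    (hpow : Function.Bijective fun a : ↥A => a ^ m) :
    ∃ F : contCocycles φ A H, (∀ n : ↥N, F.1 ⟨n, hNH n.2⟩ = f.1 n) ∧
      ∃ c : ↥A, (∀ n ∈ N, MulAut.conjNormal (φ n) c = c) ∧ MulAut.conjNormal (φ t) c = c ∧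
        F.1 ⟨t, ht⟩ = b * c := by
  have hN : ∀ h ∈ H, ∀ n ∈ N, h * n * h⁻¹ ∈ N := conj_mem_of_ker' hNH χ hker
  have hI := toSemidirect_conj_of_inv hNH hN ht f b (fun n => hinv n n.2 _)
  set x : ↥A ⋊[conjAut φ A H] ↥H := ⟨b, ⟨t, ht⟩⟩ with hx
  -- `s = t ^ m ∈ N`
  have hχpow : ∀ k : ℕ, χ (⟨t, ht⟩ ^ k) = Multiplicative.ofAdd (k : ZMod m) := fun k => by
    rw [map_pow, hχt, ← ofAdd_nsmul, nsmul_eq_mul, mul_one]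
  have hs : t ^ m ∈ N := by
    have h1 : χ (⟨t, ht⟩ ^ m) = 1 := by
      rw [hχpow, ZMod.natCast_self]
      rfl
    have := (hker _).1 h1
    simpa only [SubgroupClass.coe_pow] using this
  -- the element `u := s_f(s)⁻¹ x^m`: over `1`, centralising `s_f(N)`, fixed by `x`
  set u : ↥A ⋊[conjAut φ A H] ↥H := (toSemidirect hNH f ⟨t ^ m, hs⟩)⁻¹ * x ^ m with hu
  have right_pow : ∀ k : ℕ, (x ^ k).right = ⟨t, ht⟩ ^ k := fun k => by
    change SemidirectProduct.rightHom (x ^ k) = _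
    rw [map_pow]
    rfl
  have hu_right : u.right = 1 := by
    rw [hu, SemidirectProduct.mul_right, SemidirectProduct.inv_right, right_pow, toSemidirect_right]
    apply Subtype.ext
    simp only [Subgroup.coe_mul, Subgroup.coe_inv, SubgroupClass.coe_pow, inv_mul_cancel, Subgroup.coe_one]
  have hu_inl : u = SemidirectProduct.inl u.left := by
    conv_lhs => rw [← SemidirectProduct.inl_left_mul_inr_right u]
    rw [hu_right, map_one, mul_one]
  have hu_comm : ∀ n : ↥N, u * toSemidirect hNH f n * u⁻¹ = toSemidirect hNH f n := by
    intro n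
    have hc := toSemidirect_conj_pow hNH hN ht f b hI m n n.2
    have h1 : (⟨t ^ m * n * (t ^ m)⁻¹, hN _ (Subgroup.pow_mem H ht m) n n.2⟩ : ↥N) =
        ⟨t ^ m, hs⟩ * n * (⟨t ^ m, hs⟩)⁻¹ := Subtype.ext (by simp)
    rw [h1, map_mul, map_mul, map_inv] at hc
    -- `hc : sN s * toSemidirect hNH f n * (toSemidirect hNH f s)⁻¹ = x^m * toSemidirect hNH f n * (x^m)⁻¹`
    rw [hu]
    calc (toSemidirect hNH f ⟨t ^ m, hs⟩)⁻¹ * x ^ m * toSemidirect hNH f n * ((toSemidirect hNH f ⟨t ^ m, hs⟩)⁻¹ * x ^ m)⁻¹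
        = (toSemidirect hNH f ⟨t ^ m, hs⟩)⁻¹ * (x ^ m * toSemidirect hNH f n * (x ^ m)⁻¹) * toSemidirect hNH f ⟨t ^ m, hs⟩ := by group
      _ = toSemidirect hNH f n := by rw [← hc]; group
  have hu_t : x * u * x⁻¹ = u := by
    have h1 : x * toSemidirect hNH f ⟨t ^ m, hs⟩ * x⁻¹ = toSemidirect hNH f ⟨t ^ m, hs⟩ := by
      have h2 := hI ⟨t ^ m, hs⟩
      have h3 : (⟨t * ((⟨t ^ m, hs⟩ : ↥N) : G) * t⁻¹, hN t ht _ hs⟩ : ↥N) = ⟨t ^ m, hs⟩ :=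
        Subtype.ext (by simp only; group)
      rw [h3] at h2
      exact h2.symm
    rw [hu]
    calc x * ((toSemidirect hNH f ⟨t ^ m, hs⟩)⁻¹ * x ^ m) * x⁻¹
        = (x * toSemidirect hNH f ⟨t ^ m, hs⟩ * x⁻¹)⁻¹ * x ^ m := by group
      _ = (toSemidirect hNH f ⟨t ^ m, hs⟩)⁻¹ * x ^ m := by rw [h1]
  -- `d := u.left` is fixed by `N` and by `t`
  set d : ↥A := u.left with hd
  have hdN : ∀ n ∈ N, MulAut.conjNormal (φ n) d = d := by
    intro n hn
    have h1 := hu_comm ⟨n, hn⟩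
    rw [mul_inv_eq_iff_eq_mul, hu_inl] at h1
    have h2 := congrArg SemidirectProduct.left h1
    simp only [SemidirectProduct.mul_left, SemidirectProduct.left_inl, SemidirectProduct.right_inl, map_one,
      MulAut.one_apply, toSemidirect_left, toSemidirect_right, conjAut_apply] at h2
    -- `h2 : d * f n = f n * ⁿd`
    rw [mul_comm] at h2
    exact (mul_left_cancel h2).symm
  have hdt : MulAut.conjNormal (φ t) d = d := by
    have h1 := hu_t
    rw [mul_inv_eq_iff_eq_mul, hu_inl] at h1
    have h2 := congrArg SemidirectProduct.left h1
    simp only [SemidirectProduct.mul_left, SemidirectProduct.left_inl, SemidirectProduct.right_inl, map_one,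
      MulAut.one_apply, conjAut_apply] at h2
    -- `h2 : b * ᵗd = d * b`
    rw [mul_comm d b] at h2
    exact mul_left_cancel h2
  -- the `m`-th root `c` of `d⁻¹`, again fixed by `N` and `t`
  obtain ⟨c, hc⟩ := hpow.2 d⁻¹
  simp only at hc
  have hfix : ∀ g : G', MulAut.conjNormal g d = d → MulAut.conjNormal g c = c := by
    intro g hg
    apply hpow.1
    simp only
    rw [← map_pow, hc, map_inv, hg]
  have hcN : ∀ n ∈ N, MulAut.conjNormal (φ n) c = c := fun n hn => hfix _ (hdN n hn)
  have hct : MulAut.conjNormal (φ t) c = c := hfix _ hdt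
  -- the norm condition for `b·c`
  have hxm : x ^ m = toSemidirect hNH f ⟨t ^ m, hs⟩ * SemidirectProduct.inl d := by
    rw [← hu_inl, hu, mul_inv_cancel_left]
  have hnorm : ∀ hs' : t ^ m ∈ N, f.1 ⟨t ^ m, hs'⟩ =
      ((⟨b * c, ⟨t, ht⟩⟩ : ↥A ⋊[conjAut φ A H] ↥H) ^ m).left := by
    intro hs'
    rw [SemidirectProduct.left_mk_mul_pow_of_fixed (conjAut φ A H) b c ⟨t, ht⟩ hct m, hc]
    have h1 := congrArg SemidirectProduct.left hxm
    rw [SemidirectProduct.mul_left, SemidirectProduct.left_inl, toSemidirect_left, toSemidirect_right,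
      conjAut_apply, hdN _ hs] at h1
    -- `h1 : (x^m).1 = f(s) * d`
    rw [h1, mul_assoc, mul_inv_cancel, mul_one]
  -- the invariance identity for `b·c`
  have hinv' : ∀ (n : G) (hn : n ∈ N) (htn : t * n * t⁻¹ ∈ N), f.1 ⟨t * n * t⁻¹, htn⟩ =
      b * c * MulAut.conjNormal (φ t) (f.1 ⟨n, hn⟩) * (MulAut.conjNormal (φ (t * n * t⁻¹)) (b * c))⁻¹ := by
    intro n hn htn
    rw [hinv n hn htn, _root_.map_mul (MulAut.conjNormal (φ (t * n * t⁻¹))) b c, hcN _ htn]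
    refine Additive.ofMul.injective ?_
    simp only [ofMul_mul, ofMul_inv]
    abel
  obtain ⟨F, hFN, hFt⟩ :=
    exists_contCocycle_extension_of_zmod hφ hNopen hNH χ hker ht hχt f (b * c) hinv' hnorm
  exact ⟨F, hFN, c, hcN, hct, hFt⟩

/-! ### Index two (the [EtTh] §2 shape: no character needed) -/

/-- **Index two.**  Let `N ≤ H ≤ G` with `N` open, `t ∈ H ∖ N` with `H = N ⊔ N·t` (every `h ∈ H ∖ N`
has `h t⁻¹ ∈ N`; normality of `N` in `H` follows), and let squaring be bijective on `A` (e.g. `A` finite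
of odd order — the [EtTh] §2 use: `A = Δ_Θ/l·Δ_Θ`, `l` odd).  Then EVERY continuous cocycle `f` on `N`
whose class is `t`-invariant (witness `b`: `f(t n t⁻¹) = b · ᵗf(n) · (ᵗⁿᵗ⁻¹b)⁻¹`) extends to a continuous
cocycle `F` on `H` with `F|_N = f` and `F(t) = b·c` for some `c ∈ A` fixed by `φ(N)` and `φ(t)`
(`H²(ℤ/2, A^N) = 0`). [cite: NeukirchSchmidtWingberg2008, I §6 Prop 1.6.7] -/
theorem exists_contCocycle_extension_of_index_two (hφ : Continuous φ) (hNopen : IsOpen (N : Set G))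
    (hNH : N ≤ H) {t : G} (ht : t ∈ H) (htN : t ∉ N) (h2 : ∀ h ∈ H, h ∉ N → h * t⁻¹ ∈ N)
    (f : contCocycles φ A N) (b : ↥A)
    (hinv : ∀ (n : G) (hn : n ∈ N) (htn : t * n * t⁻¹ ∈ N), f.1 ⟨t * n * t⁻¹, htn⟩ =
      b * MulAut.conjNormal (φ t) (f.1 ⟨n, hn⟩) * (MulAut.conjNormal (φ (t * n * t⁻¹)) b)⁻¹)
    (hpow : Function.Bijective fun a : ↥A => a ^ 2) :
    ∃ F : contCocycles φ A H, (∀ n : ↥N, F.1 ⟨n, hNH n.2⟩ = f.1 n) ∧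
      ∃ c : ↥A, (∀ n ∈ N, MulAut.conjNormal (φ n) c = c) ∧ MulAut.conjNormal (φ t) c = c ∧
        F.1 ⟨t, ht⟩ = b * c := by
  classical
  -- normality of `N` in `H` and `t² ∈ N`, from `H = N ⊔ N t`
  have hconj : ∀ n ∈ N, t * n * t⁻¹ ∈ N := fun n hn =>
    h2 (t * n) (H.mul_mem ht (hNH hn)) (fun htn => htN (by simpa using N.mul_mem htn (N.inv_mem hn)))
  have ht2 : t * t ∈ N := by
    have h := h2 t⁻¹ (H.inv_mem ht) (fun h' => htN (by simpa using N.inv_mem h'))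
    simpa using N.inv_mem h
  -- the character `χ : H → ℤ/2` with kernel `N`
  let χ₀ : ↥H → Multiplicative (ZMod 2) := fun h => if (h : G) ∈ N then 1 else Multiplicative.ofAdd 1
  have hχ₀N : ∀ h : ↥H, (h : G) ∈ N → χ₀ h = 1 := fun h hh => if_pos hh
  have hχ₀notN : ∀ h : ↥H, (h : G) ∉ N → χ₀ h = Multiplicative.ofAdd 1 := fun h hh => if_neg hh
  have hmul : ∀ h h' : ↥H, χ₀ (h * h') = χ₀ h * χ₀ h' := by
    intro h h'
    by_cases hh : (h : G) ∈ N <;> by_cases hh' : (h' : G) ∈ N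
    · rw [hχ₀N h hh, hχ₀N h' hh', hχ₀N (h * h') (N.mul_mem hh hh'), one_mul]
    · have : ((h * h' : ↥H) : G) ∉ N := fun hm =>
        hh' (by simpa using N.mul_mem (N.inv_mem hh) hm)
      rw [hχ₀N h hh, hχ₀notN h' hh', hχ₀notN _ this, one_mul]
    · have : ((h * h' : ↥H) : G) ∉ N := fun hm =>
        hh (by simpa using N.mul_mem hm (N.inv_mem hh'))
      rw [hχ₀notN h hh, hχ₀N h' hh', hχ₀notN _ this, mul_one]
    · have hm : ((h * h' : ↥H) : G) ∈ N := by
        have e : ((h * h' : ↥H) : G) = (h : G) * t⁻¹ * (t * ((h' : G) * t⁻¹) * t⁻¹) * (t * t) := by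
          simp only [Subgroup.coe_mul]; group
        rw [e]
        exact N.mul_mem (N.mul_mem (h2 _ h.2 hh) (hconj _ (h2 _ h'.2 hh'))) ht2
      rw [hχ₀notN h hh, hχ₀notN h' hh', hχ₀N _ hm]
      decide
  let χ : ↥H →* Multiplicative (ZMod 2) :=
    { toFun := χ₀, map_one' := hχ₀N 1 (by simp), map_mul' := hmul }
  have hker : ∀ h : ↥H, χ h = 1 ↔ (h : G) ∈ N := by
    intro h
    refine ⟨fun hh => ?_, fun hh => hχ₀N h hh⟩
    by_contra hn
    have : χ₀ h = Multiplicative.ofAdd 1 := hχ₀notN h hn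
    exact absurd (this.symm.trans hh) (by decide)
  have hχt : χ ⟨t, ht⟩ = Multiplicative.ofAdd 1 := hχ₀notN ⟨t, ht⟩ htN
  exact exists_contCocycle_extension_of_zmod_of_powBijective hφ hNopen hNH χ hker ht hχt f b hinv hpow

end ContH1

end Literature.AnabelianGeometry.EtaleTheta
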